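import Summits.HodgeConjecture.HodgeConjecture.Theses.HeckePrymWeil
import Literature.AlgebraicGeometry.Motives.AbelianVarietyProjectiveChart

/-!
# `SummitOffWeilSector` (stmt-HodgeConjecture-1264) · Negative · the crux is exactly conjecture-grade

Negative-side knowledge for the crux `HeckePrymWeil.SummitOffWeilSector` (the route's declared
"NOT CLAIMED" remainder `WeilSector → HodgeConjecture`), from the standing disprover's work file
`Cruxes/SummitOffWeilSector/Disproof.lean` §1–§2 (refuter-cdisprove-stmt-HodgeConjecture-1264-0, cycle 1,
2026-08-16), negative forms only:

* `not_hodgeConjecture_of_not_summitOffWeilSector` : `¬ SummitOffWeilSector → ¬ HodgeConjecture` — the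
  crux is an implication whose conclusion is the summit, so ANY refutation of it is a disproof of the
  Clay problem;
* `antecedent_of_hodgeConjecture` : the crux's antecedent (the whole ℚ(√-p) Hodge–Weil sector, written
  out verbatim) is itself a special case of `HodgeConjecture`, because abelian varieties are smooth
  projective (the tree's PROVED `AbelianVariety.isSmoothProjective_holds`);
* `not_summitOffWeilSector_iff` : consequently `¬ SummitOffWeilSector ↔ (antecedent ∧ ¬ HodgeConjecture)`:
  a kill must BOTH prove every ℚ(√-p) Hodge–Weil class algebraic (p ≡ 3 (4), p ≥ 7, all dimensions —
  this contains the route's target `HodgeWeilLadder`, `WeilDescending` and the three rung cruxes) AND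
  refute the Hodge conjecture; and the crux can only be PROVED by proving `HodgeConjecture` or by refuting
  its antecedent (`not_hodgeConjecture_of_not_antecedent`: which again refutes `HodgeConjecture`).
-/

noncomputable section

set_option linter.dupNamespace false

open CategoryTheory Complex

namespace Summit.HodgeConjecture.HodgeConjecture.Theorems.SummitOffWeilSector.Negative

open Literature.AlgebraicGeometry.Motives Literature.AlgebraicGeometry.HodgeTheory
open Summit.HodgeConjecture.HodgeConjecture.Theses.HeckePrymWeil

/-- **A kill of the crux is a disproof of the Hodge conjecture**: `HodgeConjecture → SummitOffWeilSector`
trivially (the crux is `_ → HodgeConjecture`), contraposed. [folklore] -/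
theorem not_hodgeConjecture_of_not_summitOffWeilSector (h : ¬ SummitOffWeilSector) :
    ¬ _root_.HodgeConjecture :=
  fun hHC => h fun _ => hHC

/-- **The antecedent of the crux is a special case of its conclusion**: every rung of the ℚ(√-p)
Hodge–Weil sector follows from `HodgeConjecture`, abelian varieties being smooth projective of dimension
`dim A` (`AbelianVariety.isSmoothProjective_holds`, Görtz–Wedhorn II Prop. 27.174). [folklore] -/
theorem antecedent_of_hodgeConjecture (hHC : _root_.HodgeConjecture) :
    ∀ p : ℕ, p.Prime → p % 4 = 3 → 7 ≤ p → ∀ n : ℕ, 1 ≤ n →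
      ∀ (A : AbelianVariety ℂ) (φ : A ⟶ A), A.dim = (2 * n) → φ ≫ φ = -((p : ℤ) • 𝟙 A) →
        ∀ c : complexBetti A.X (2 * n), IsRationalClass c → IsOfHodgeType (2 * n) A.X (2 * n) n n c →
          c ∈ Module.End.eigenspace (complexBetti.map (𝟙 A + φ).hom.hom.hom (2 * n)).hom
                ((1 + I * (Real.sqrt (p : ℝ) : ℂ)) ^ (2 * n)) ⊔
              Module.End.eigenspace (complexBetti.map (𝟙 A + φ).hom.hom.hom (2 * n)).hom
                ((1 - I * (Real.sqrt (p : ℝ) : ℂ)) ^ (2 * n)) →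
          c ∈ algebraicClasses A.X n := by
  intro p _ _ _ n _ A φ hdim _ c hrat hhodge _
  have hsp : IsSmoothProjective (2 * n) A.X := by
    have h := (AbelianVariety.isSmoothProjective_holds (A := A))
    rw [AbelianVariety.isSmoothProjective, hdim] at h
    exact h
  exact (hHC hsp).2 n c hrat hhodge

/-- **Exact status of the crux**: it fails iff the whole ℚ(√-p) Hodge–Weil sector holds and the Hodge
conjecture fails. [folklore] -/
theorem not_summitOffWeilSector_iff :
    ¬ SummitOffWeilSector ↔
      ((∀ p : ℕ, p.Prime → p % 4 = 3 → 7 ≤ p → ∀ n : ℕ, 1 ≤ n →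
        ∀ (A : AbelianVariety ℂ) (φ : A ⟶ A), A.dim = (2 * n) → φ ≫ φ = -((p : ℤ) • 𝟙 A) →
          ∀ c : complexBetti A.X (2 * n), IsRationalClass c → IsOfHodgeType (2 * n) A.X (2 * n) n n c →
            c ∈ Module.End.eigenspace (complexBetti.map (𝟙 A + φ).hom.hom.hom (2 * n)).hom
                  ((1 + I * (Real.sqrt (p : ℝ) : ℂ)) ^ (2 * n)) ⊔
                Module.End.eigenspace (complexBetti.map (𝟙 A + φ).hom.hom.hom (2 * n)).hom
                  ((1 - I * (Real.sqrt (p : ℝ) : ℂ)) ^ (2 * n)) →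
            c ∈ algebraicClasses A.X n) ∧ ¬ _root_.HodgeConjecture) :=
  Classical.not_imp

/-- The only other way to PROVE the crux — refuting its antecedent — also refutes the Hodge conjecture
(contrapositive of `antecedent_of_hodgeConjecture`). [folklore] -/
theorem not_hodgeConjecture_of_not_antecedent
    (h : ¬ ∀ p : ℕ, p.Prime → p % 4 = 3 → 7 ≤ p → ∀ n : ℕ, 1 ≤ n →
      ∀ (A : AbelianVariety ℂ) (φ : A ⟶ A), A.dim = (2 * n) → φ ≫ φ = -((p : ℤ) • 𝟙 A) →
        ∀ c : complexBetti A.X (2 * n), IsRationalClass c → IsOfHodgeType (2 * n) A.X (2 * n) n n c →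
          c ∈ Module.End.eigenspace (complexBetti.map (𝟙 A + φ).hom.hom.hom (2 * n)).hom
                ((1 + I * (Real.sqrt (p : ℝ) : ℂ)) ^ (2 * n)) ⊔
              Module.End.eigenspace (complexBetti.map (𝟙 A + φ).hom.hom.hom (2 * n)).hom
                ((1 - I * (Real.sqrt (p : ℝ) : ℂ)) ^ (2 * n)) →
          c ∈ algebraicClasses A.X n) :
    ¬ _root_.HodgeConjecture :=
  fun hHC => h (antecedent_of_hodgeConjecture hHC)

end Summit.HodgeConjecture.HodgeConjecture.Theorems.SummitOffWeilSector.Negative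

end
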